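import Mathlib
import Summits.Ventures.HodgeRepro2.Hypothesis
import Summits.Ventures.HodgeRepro2.CongruenceFiniteIndex
import Summits.Ventures.HodgeRepro2.LevelFiniteIndex

/-!
# Shimura's level for the standard lattice is the principal congruence subgroup inside `SU(H)`

`Hypothesis.lean` records two families of level groups: Shimura's `Γ_N = shimuraLevel K H 𝔪 N`
(determinant one, stabilising a lattice `𝔪 ⊆ K^m`, acting trivially on `𝔪 / N𝔪`; (4.14)) and
DR15's `Γ(𝔑) = principalCongruence K H 𝔑` (entrywise integral unitary matrices `≡ 1 (mod 𝔑)`).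
For the standard lattice `𝓞_K^m` they coincide inside `SU(H)`:

* `standardLattice K m`: the vectors of `K^m` with integral entries, as a `ℤ`-submodule;
  `isLattice_standardLattice`: it is an `IsLattice` (finitely generated as the image of `(𝓞 K)^m`,
  `ℚ`-spanning by clearing denominators: `IsAlgebraic.exists_nsmul_eq`).
* `vecMul_mem_standardLattice_iff`: a matrix preserves `𝓞_K^m` iff its entries are integral.
* `congruence_standardLattice_iff`: the clause `x − xγ ∈ N𝔪` of (4.14) is `CongruentToOne K (N𝓞_K) γ`.
* **`shimuraLevel_standardLattice`**: `shimuraLevel K H 𝓞_K^m N = SU(H) ∩ Γ(N𝓞_K)` as sets;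
  `principalCongruence_top`: `Γ(𝓞_K) = U(L)_𝓞`; `shimuraLevel_standardLattice_one`:
  `Γ_1 = SU(H) ∩ U(L)_𝓞`; `isFiniteIndexSubgroupOf_standardLattice`: the finite-index statement
  of `LevelFiniteIndex` read on this lattice.

Everything is proved; no new axioms.
-/

namespace Summit.Ventures.HodgeRepro2.ShimuraData

open Matrix NumberField

section Lattice

variable (K : Type*) [Field K] (m : ℕ)

/-- The standard lattice `𝓞_K^m ⊆ K^m`: the vectors with integral entries. -/
def standardLattice : Submodule ℤ (Fin m → K) where
  carrier := {x | ∀ i, IsIntegral ℤ (x i)}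
  zero_mem' := fun i => by rw [Pi.zero_apply]; exact isIntegral_zero
  add_mem' := fun {x y} hx hy i => by simpa using (hx i).add (hy i)
  smul_mem' := fun c {x} hx i => by simpa using (hx i).smul c

variable {K m}

/-- Membership in the standard lattice. -/
theorem mem_standardLattice {x : Fin m → K} :
    x ∈ standardLattice K m ↔ ∀ i, IsIntegral ℤ (x i) := Iff.rfl

/-- The standard basis vectors lie in the standard lattice. -/
theorem single_mem_standardLattice (i : Fin m) : Pi.single i (1 : K) ∈ standardLattice K m := by
  intro j
  rw [Pi.single_apply]
  split_ifs
  · exact isIntegral_one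
  · exact isIntegral_zero

/-- `(𝓞 K)^m → K^m`, entrywise, as a `ℤ`-linear map. -/
def standardLatticeMap : (Fin m → 𝓞 K) →ₗ[ℤ] (Fin m → K) where
  toFun a i := algebraMap (𝓞 K) K (a i)
  map_add' a b := by ext; simp
  map_smul' c a := by ext; simp

/-- The image of `(𝓞 K)^m` is the standard lattice. -/
theorem range_standardLatticeMap :
    LinearMap.range (standardLatticeMap (K := K) (m := m)) = standardLattice K m := by
  ext x
  constructor
  · rintro ⟨a, rfl⟩ i
    exact RingOfIntegers.isIntegral_coe (a i)
  · intro hx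
    exact ⟨fun i => ⟨x i, hx i⟩, rfl⟩

/-- Every element of a number field is algebraic over `ℤ`. -/
theorem isAlgebraic_int_of_numberField [NumberField K] (x : K) : IsAlgebraic ℤ x := by
  haveI : Algebra.IsAlgebraic ℤ ℚ := IsLocalization.isAlgebraic ℚ (nonZeroDivisors ℤ)
  haveI : Algebra.IsAlgebraic ℤ K := Algebra.IsAlgebraic.trans ℤ ℚ K
  exact Algebra.IsAlgebraic.isAlgebraic x

/-- Clearing denominators: a non-zero natural multiple of every vector lies in the lattice. -/
theorem exists_nsmul_mem_standardLattice [NumberField K] (x : Fin m → K) :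
    ∃ n : ℕ, n ≠ 0 ∧ n • x ∈ standardLattice K m := by
  have h : ∀ i, ∃ (n : ℕ) (s : 𝓞 K), n ≠ 0 ∧ n • x i = algebraMap (𝓞 K) K s := fun i =>
    (isAlgebraic_int_of_numberField (x i)).exists_nsmul_eq (S := 𝓞 K)
  choose n s hn hs using h
  refine ⟨∏ i, n i, Finset.prod_ne_zero_iff.2 fun i _ => hn i, fun i => ?_⟩
  rw [Pi.smul_apply, ← Finset.mul_prod_erase Finset.univ n (Finset.mem_univ i), mul_comm, mul_smul,
    hs i, ← natCast_zsmul]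
  exact (RingOfIntegers.isIntegral_coe (s i)).smul _

/-- The standard lattice is a lattice in the sense of `IsLattice`. -/
theorem isLattice_standardLattice [NumberField K] : IsLattice K (standardLattice K m) := by
  refine ⟨?_, ?_⟩
  · rw [← range_standardLatticeMap]
    infer_instance
  · rw [eq_top_iff]
    rintro x -
    obtain ⟨n, hn, hnx⟩ := exists_nsmul_mem_standardLattice x
    have hx : x = ((n : ℚ)⁻¹) • ((n : ℚ) • x) := by
      rw [smul_smul, inv_mul_cancel₀ (by exact_mod_cast hn), one_smul]
    rw [hx]
    refine Submodule.smul_mem _ _ (Submodule.subset_span ?_)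
    rw [Nat.cast_smul_eq_nsmul]
    exact hnx

end Lattice

section Level

variable {K : Type*} [Field K] [NumberField K] [NumberField.IsCMField K] {m : ℕ}
variable (H : Matrix (Fin m) (Fin m) K)

omit [NumberField K] [NumberField.IsCMField K] in
/-- A matrix preserves the standard lattice (by `x ↦ x ᵥ* γ`) iff its entries are integral. -/
theorem vecMul_mem_standardLattice_iff (γ : Matrix (Fin m) (Fin m) K) :
    (∀ x ∈ standardLattice K m, x ᵥ* γ ∈ standardLattice K m) ↔
      ∀ i j, IsIntegral ℤ (γ i j) := by
  constructor
  · intro h i j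
    have := h _ (single_mem_standardLattice i) j
    rwa [Matrix.single_one_vecMul] at this
  · intro h x hx j
    rw [Matrix.vecMul, dotProduct]
    exact IsIntegral.sum _ fun i _ => (hx i).mul (h i j)

omit [NumberField K] [NumberField.IsCMField K] in
/-- The clause `x − xγ ∈ N𝔪` of (4.14), on the standard lattice, is `γ ≡ 1 (mod N𝓞_K)`. -/
theorem congruence_standardLattice_iff (γ : Matrix (Fin m) (Fin m) K) (N : ℕ) :
    (∀ x ∈ standardLattice K m, ∃ y ∈ standardLattice K m, x - x ᵥ* γ = (N : ℤ) • y) ↔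
      CongruentToOne K (Ideal.span {(N : 𝓞 K)}) γ := by
  constructor
  · intro h i j
    obtain ⟨y, hy, hxy⟩ := h _ (single_mem_standardLattice i)
    have hj := congrFun hxy j
    simp only [Pi.sub_apply, Matrix.single_one_vecMul, Matrix.row, Pi.smul_apply, zsmul_eq_mul,
      Int.cast_natCast] at hj
    refine ⟨-((N : 𝓞 K) * ⟨y j, hy j⟩), ?_, ?_⟩
    · rw [Ideal.mem_span_singleton]
      exact (dvd_mul_right _ _).neg_right
    · have h1 : (1 : Matrix (Fin m) (Fin m) K) i j = (Pi.single i (1 : K) : Fin m → K) j := by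
        rw [Matrix.one_apply, Pi.single_apply]
        by_cases hij : i = j
        · simp [hij]
        · simp [hij, Ne.symm hij]
      rw [map_neg, map_mul, map_natCast, RingOfIntegers.map_mk, h1]
      linear_combination -hj
  · intro hc x hx
    choose a ha using hc
    have hb : ∀ i j, ∃ b : 𝓞 K, a i j = (N : 𝓞 K) * b := fun i j =>
      Ideal.mem_span_singleton.1 (ha i j).1
    choose b hb using hb
    refine ⟨fun j => -∑ i, x i * algebraMap (𝓞 K) K (b i j), fun j => ?_, ?_⟩
    · exact (IsIntegral.sum _ fun i _ => (hx i).mul (RingOfIntegers.isIntegral_coe _)).neg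
    · funext j
      have hxj : x j = ∑ i, x i * (1 : Matrix (Fin m) (Fin m) K) i j := by
        simp [Matrix.one_apply]
      have hij : ∀ i, γ i j - (1 : Matrix (Fin m) (Fin m) K) i j =
          (N : K) * algebraMap (𝓞 K) K (b i j) := by
        intro i
        have := (ha i j).2
        rwa [hb i j, map_mul, map_natCast] at this
      simp only [Pi.sub_apply, Matrix.vecMul, dotProduct, Pi.smul_apply, zsmul_eq_mul,
        Int.cast_natCast]
      conv_lhs => rw [hxj]
      rw [← Finset.sum_sub_distrib, mul_neg, Finset.mul_sum, ← Finset.sum_neg_distrib]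
      refine Finset.sum_congr rfl fun i _ => ?_
      linear_combination (-(x i)) * hij i

/-- **Shimura's level for the standard lattice is `SU(H) ∩ Γ(N𝓞_K)`.** -/
theorem shimuraLevel_standardLattice (N : ℕ) :
    shimuraLevel K H (standardLattice K m) N =
      (specialUnitaryGroup K H : Set (GL (Fin m) K)) ∩
        principalCongruence K H (Ideal.span {(N : 𝓞 K)}) := by
  ext γ
  simp only [Set.mem_inter_iff, SetLike.mem_coe]
  constructor
  · rintro ⟨hsu, hγ, hγ', hc⟩
    have hi := (vecMul_mem_standardLattice_iff _).1 hγ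
    exact ⟨hsu, ⟨hsu.1, hi, (vecMul_mem_standardLattice_iff _).1 hγ'⟩,
      (congruence_standardLattice_iff _ N).1 hc⟩
  · rintro ⟨hsu, ⟨_, hi, hi'⟩, hc⟩
    exact ⟨hsu, (vecMul_mem_standardLattice_iff _).2 hi, (vecMul_mem_standardLattice_iff _).2 hi',
      (congruence_standardLattice_iff _ N).2 hc⟩

/-- `Γ(𝓞_K) = U(L)_𝓞`: every integral matrix is `≡ 1 (mod 𝓞_K)`. -/
theorem principalCongruence_top : principalCongruence K H ⊤ = integralUnitaryGroup K H := by
  ext γ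
  refine ⟨fun h => h.1, fun h => ⟨h, fun i j => ?_⟩⟩
  exact ⟨⟨_, (h.2.1 i j).sub (isIntegral_entries_one i j)⟩, Submodule.mem_top, rfl⟩

/-- `Γ_1` for the standard lattice is `SU(H) ∩ U(L)_𝓞`. -/
theorem shimuraLevel_standardLattice_one :
    shimuraLevel K H (standardLattice K m) 1 =
      (specialUnitaryGroup K H : Set (GL (Fin m) K)) ∩ integralUnitaryGroup K H := by
  rw [shimuraLevel_standardLattice, Nat.cast_one, Ideal.span_singleton_one, principalCongruence_top]

/-- The finite-index statement of `LevelFiniteIndex`, read on the standard lattice: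
`SU(H) ∩ Γ(N𝓞_K)` has finite index in `SU(H) ∩ U(L)_𝓞` for `N ≠ 0`. -/
theorem isFiniteIndexSubgroupOf_standardLattice {N : ℕ} (hN : N ≠ 0) :
    IsFiniteIndexSubgroupOf K
      ((specialUnitaryGroup K H : Set (GL (Fin m) K)) ∩
        principalCongruence K H (Ideal.span {(N : 𝓞 K)}))
      ((specialUnitaryGroup K H : Set (GL (Fin m) K)) ∩ integralUnitaryGroup K H) := by
  rw [← shimuraLevel_standardLattice, ← shimuraLevel_standardLattice_one]
  exact isFiniteIndexSubgroupOf_shimuraLevel_one H _ isLattice_standardLattice hN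

end Level

end Summit.Ventures.HodgeRepro2.ShimuraData
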